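import Summits.QuantumFields.YangMills.Theorems.UnitScaleTiltProp7TransplantCutoffPotential
import Summits.QuantumFields.YangMills.Theorems.UnitScaleTiltProp7TransplantNorms
import Summits.QuantumFields.YangMills.Theorems.UnitScaleTiltProp7TorusGreenConvolution
import HarnessLib

/-!
# Route `UnitScaleTilt`, crux K1 «MinimiserStabilityRegPr» (stmt-QuantumFields-19200), route-R E′ path (α′), (E1-b) at the CURVED background, (A-cov) gen-0, FILE «GEN-0 NUMBERS»:
# THE NUMBERS OF THE gen-0 TRANSPLANT `V⁰ = ψ•R(Fr)Y` ON THE BALL `S = {tdist(·,b) ≤ 9n}` UNDER CONE ROWS — (N2⁰) `Σ_z √hs(Δ_U V⁰ z) ≤ √hs Y·C(9 + 1728n + #S∕n²) + √N‖Y‖·#S·d·B`,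
# (E₁) `‖E₁ z‖ ≤ d·B·‖Y‖` on `S`, `0` off; (H⁰) `√Σω²hs(E₁ + c₁•R(Fr)Y) ≤ Ω√#S·(√N·d·B·‖Y‖ + C√hs Y∕n²)`; (S⁰) `√Σω²hs(c₂•R(Fr)Y) ≤ Ω√#S·C√hs Y∕n⁴`; (J) the gen-1 density
# `‖E₂ z‖ ≤ d·B·C·‖Y‖∕(1∨r)²` on `S`, `0` off — with `B := (2T₂ + 4T₁²)·C + 8A₁C`-type constants in the cone letters `t₁ z ≤ A₁(r+1)`, `t₂ z ≤ A₀ + A₂(r+2)` of ✓p676751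

Cell `ym3-torus`, width seat `ym3-torus-px22` (gen 3); gen-0 file 3 (files 1–2 = ✓p677890, ✓p678469); letters = ✓p675919 `Prop7TransplantNorms` (engine), ✓p674125 (pointwise), ✓p678447 `covBilaplace_two_generation'`
(`E₁ E₂` bound by their defining equations), ✓p677235 (the door: `H`, `S` numbers are `√Σω²hs`).  THEOREMS ONLY (0 `def`, 0 `sorry`); `--supports stmt-QuantumFields-19200`, count-neutral.  YM₃ on T³ is a ladder rung (R3),
not the Clay problem; nothing here claims the stub, the crux, d = 4 or the gap.

WHAT IS PROVED (ns `…Theorems.Prop7TransplantGen0Numbers`; `Site P 0`, `P.d = 3`, pole `b`, `r = tdist(·,b)`, scale `n ≥ 2` (`ℓ_c := n`), `S := {z | tdist z b ≤ 9n}`, `T = torusT P 0`,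
bi-contractive `U`, `Fr`; cone functions `t₁ t₂` with `0 ≤ t₁ z ≤ A₁(r+1)`, `t₂ z ≤ A₀ + A₂(r+2)` on `S`; `T₁ := A₁(9n+1)`, `T₂ := A₀ + A₂(9n+2)`, `B := (2T₂ + 4T₁²)·C + 8A₁·C`).
* §1 letters: `mem_ball_iff`, `not_mem_ball`, `card_ball_le`, `add_one_le_two_mul_max`, ★ `sqrt_weighted_hs_le_of_pointwise` (`√Σω²hs(F) ≤ Ω√#S·B` for `F` vanishing off `S`, `√hs F ≤ B` on `S`).
* §2 ★★ `junk_term_le` (one site: `Σ_μ[(2t₂+4t₁²)|ψ| + 2t₁(|∂⁺ψ| + |∂⁻ψ|)] ≤ d·B`), ★★ `density_term_le` (one site, the `g`-version: `≤ d·B∕(1∨r)²`).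
* §3 ★★★ `exists_gen0_numbers` — `∃ C ≥ 0` absolute, `∀ P (d = 3) k b μ n ≥ 2, ∃ ψ g c₁ c₂` (✓p678469's, with their support∕identities∕rows re-exported) `∧ ∀ U Fr t₁ t₂ A₀ A₁ A₂ (cone rows on S) Y ω Ω`:
  (N2⁰), (E₁ pointwise + vanishing), (H⁰), (S⁰), (J pointwise + vanishing).
HONEST SCOPE.  Counting over landed engines; the near datum, the member's frame∕weight instantiation and gen-1 are other files.

References: T. Bałaban, CMP 99 (1985) 389–434 [Balaban1985BackgroundPropagators] ((3.8) p.392, (3.35) p.396); CMP 96 (1984) 223–250 [Balaban1984PropagatorsII] ((1.9) p.226); CMP 99 (1985) 75–102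
[Balaban1985RegularSpaces] ((1.36) p.82).
-/

set_option autoImplicit false

noncomputable section

open scoped BigOperators Matrix.Norms.L2Operator Matrix
open Finset

namespace Summit.QuantumFields.YangMills.Theorems.Prop7TransplantGen0Numbers

open Literature.MathematicalPhysics.QuantumFieldTheory.Balaban1983to89
open B9Eq39Adjoint (R R_def covD covDstar divB)
open B9TorusCalculus (torusT torusT_apply torusT_symm_apply)
open B3Taylor310LocalRemainder (tdist_comm tdist_self)
open Prop7PinnedKernelGeometry (tdist_le_tdist_shift_add_one tdist_le_tdist_unshift_add_one)
open Prop7TransplantCutoffPotential (exists_cutoffPotential)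
open Prop7TransplantNorms (hs_R_le sqrt_hs_smul covLaplace_eq_zero_of_vanish sum_sqrt_hs_covLaplace_framedConst_le)
open Prop7FramedScalarMatrix (norm_covLaplace_framedConst_sub_le)
open Prop7HSOpNormSeam (sqrt_hs_le_sqrt_card_mul_norm)
open Prop7CovPinnedKernelL1OfRows (sqrt_hs_add_le)
open Prop7TorusGreenConvolution (sum_inv_max_sq_le)
open Prop7TorusRadialSums (card_ball_le_real)

variable {P : Params} {N : ℕ}

/-! ## §1 Letters: the ball, the weighted `ℓ²` number from a pointwise bound -/

/-- membership in the ball `S = {tdist(·,b) ≤ R}`. [folklore] -/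
theorem mem_ball_iff (b z : Site P 0) (R : ℕ) : z ∈ (univ.filter fun z : Site P 0 => Site.tdist z b ≤ R) ↔ Site.tdist z b ≤ R := by
  simp only [Finset.mem_filter, Finset.mem_univ, true_and]

/-- off the ball `{tdist ≤ 9n}` a site and its neighbours are at distance `≥ 9n`. [folklore] -/
theorem not_mem_ball (b z : Site P 0) (n : ℕ) (hz : z ∉ (univ.filter fun z : Site P 0 => Site.tdist z b ≤ 9 * n)) :
    (9 * n : ℝ) + 1 ≤ (Site.tdist z b : ℝ) ∧ (∀ μ, (9 * n : ℝ) ≤ (Site.tdist (torusT P 0 μ z) b : ℝ)) ∧ ∀ μ, (9 * n : ℝ) ≤ (Site.tdist ((torusT P 0 μ).symm z) b : ℝ) := by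
  rw [mem_ball_iff, not_le] at hz
  refine ⟨by exact_mod_cast hz, fun μ => ?_, fun μ => ?_⟩
  · rw [torusT_apply]
    have := tdist_le_tdist_shift_add_one z b μ
    have h' : 9 * n ≤ Site.tdist (z.shift μ) b := by omega
    exact_mod_cast h'
  · rw [torusT_symm_apply]
    have := tdist_le_tdist_unshift_add_one z b μ
    have h' : 9 * n ≤ Site.tdist (z.unshift μ) b := by omega
    exact_mod_cast h'

/-- `#S ≤ (2(9n+1))^d`. [folklore] -/
theorem card_ball_le (b : Site P 0) (n : ℕ) : (((univ.filter fun z : Site P 0 => Site.tdist z b ≤ 9 * n)).card : ℝ) ≤ (2 * ((9 * n : ℝ) + 1)) ^ P.d := by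
  have h := card_ball_le_real (P := P) (j := 0) b (9 * n)
  push_cast at h
  exact h

omit P N in
/-- `r + 1 ≤ 2·(1 ∨ r)`. [folklore] -/
theorem add_one_le_two_mul_max (r : ℕ) : (r : ℝ) + 1 ≤ 2 * max 1 (r : ℝ) := by
  have h1 : (1 : ℝ) ≤ max 1 (r : ℝ) := le_max_left _ _
  have h2 : (r : ℝ) ≤ max 1 (r : ℝ) := le_max_right _ _
  linarith

/-- ★ **WEIGHTED `ℓ²` FROM A POINTWISE BOUND**: `F = 0` off a finset `S`, `√hs(F z) ≤ B` and `0 ≤ ω z ≤ Ω` on `S` ⇒ `√(Σ_z ω z²·hs(F z)) ≤ Ω·√#S·B`. [cite: Balaban1984PropagatorsII, (1.9) p.226] -/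
theorem sqrt_weighted_hs_le_of_pointwise (S : Finset (Site P 0)) (F : Site P 0 → Matrix (Fin N) (Fin N) ℂ) (hF : ∀ z ∉ S, F z = 0)
    (ω : Site P 0 → ℝ) {Ω B : ℝ} (hω : ∀ z ∈ S, 0 ≤ ω z ∧ ω z ≤ Ω) (hB0 : 0 ≤ B)
    (hB : ∀ z ∈ S, Real.sqrt (∑ j : Fin N, ∑ k : Fin N, ‖(F z) j k‖ ^ 2) ≤ B) :
    Real.sqrt (∑ z, ω z ^ 2 * ∑ j : Fin N, ∑ k : Fin N, ‖(F z) j k‖ ^ 2) ≤ Ω * Real.sqrt S.card * B := by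
  have hoff : ∀ z ∈ (univ : Finset (Site P 0)), z ∉ S → ω z ^ 2 * ∑ j : Fin N, ∑ k : Fin N, ‖(F z) j k‖ ^ 2 = 0 := by
    intro z _ hz
    simp [hF z hz]
  rw [← Finset.sum_subset (Finset.subset_univ S) hoff]
  have hle : ∑ z ∈ S, ω z ^ 2 * ∑ j : Fin N, ∑ k : Fin N, ‖(F z) j k‖ ^ 2 ≤ ∑ _z ∈ S, Ω ^ 2 * B ^ 2 := by
    refine Finset.sum_le_sum fun z hz => ?_
    have h0 : 0 ≤ ∑ j : Fin N, ∑ k : Fin N, ‖(F z) j k‖ ^ 2 := Finset.sum_nonneg fun _ _ => Finset.sum_nonneg fun _ _ => sq_nonneg _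
    have hhs : ∑ j : Fin N, ∑ k : Fin N, ‖(F z) j k‖ ^ 2 ≤ B ^ 2 := by
      rw [← Real.sq_sqrt h0]
      exact pow_le_pow_left₀ (Real.sqrt_nonneg _) (hB z hz) 2
    exact mul_le_mul (pow_le_pow_left₀ (hω z hz).1 (hω z hz).2 2) hhs h0 (sq_nonneg _)
  rcases S.eq_empty_or_nonempty with hS0 | ⟨z₀, hz₀⟩
  · subst hS0
    rw [Finset.sum_empty, Real.sqrt_zero, Finset.card_empty, Nat.cast_zero, Real.sqrt_zero, mul_zero, zero_mul]
  have hΩ : 0 ≤ Ω := (hω z₀ hz₀).1.trans (hω z₀ hz₀).2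
  calc _ ≤ Real.sqrt (∑ _z ∈ S, Ω ^ 2 * B ^ 2) := Real.sqrt_le_sqrt hle
    _ = Ω * Real.sqrt S.card * B := by
        rw [Finset.sum_const, nsmul_eq_mul, show (S.card : ℝ) * (Ω ^ 2 * B ^ 2) = (Ω * Real.sqrt S.card * B) ^ 2 by
          rw [mul_pow, mul_pow, Real.sq_sqrt (Nat.cast_nonneg _)]; ring]
        exact Real.sqrt_sq (mul_nonneg (mul_nonneg hΩ (Real.sqrt_nonneg _)) hB0)

/-! ## §2 One-site bounds: the junk term and the gen-1 density term under cone rows -/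

/-- ★★ **THE JUNK TERM AT ONE SITE OF THE BALL**: cone rows `0 ≤ t₁ z ≤ A₁(r+1)`, `t₂ z ≤ A₀ + A₂(r+2)`, `r ≤ 9n`, and the radial rows `|ψ| ≤ C`, `|ψ(T_μ^{±}z) − ψ z| ≤ C∕(1∨r)` give
`Σ_μ[(2t₂ z + 4(t₁ z)²)|ψ z| + 2t₁ z|ψ(T_μz) − ψ z| + 2t₁ z|ψ(T_μ⁻¹z) − ψ z|] ≤ d·((2(A₀ + A₂(9n+2)) + 4(A₁(9n+1))²)·C + 8A₁C)`. [cite: Balaban1985BackgroundPropagators, (3.35) p.396] -/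
theorem junk_term_le (b z : Site P 0) (n : ℕ) (hz : Site.tdist z b ≤ 9 * n) (ψ t₁ t₂ : Site P 0 → ℝ) {A₀ A₁ A₂ C : ℝ} (hA₀ : 0 ≤ A₀) (hA₁ : 0 ≤ A₁) (hA₂ : 0 ≤ A₂) (hC : 0 ≤ C)
    (ht₁ : 0 ≤ t₁ z ∧ t₁ z ≤ A₁ * ((Site.tdist z b : ℝ) + 1)) (ht₂ : t₂ z ≤ A₀ + A₂ * ((Site.tdist z b : ℝ) + 2))
    (hψ0 : |ψ z| ≤ C) (hψ1 : ∀ μ, |ψ (torusT P 0 μ z) - ψ z| ≤ C / max 1 ((Site.tdist z b : ℕ) : ℝ) ∧ |ψ ((torusT P 0 μ).symm z) - ψ z| ≤ C / max 1 ((Site.tdist z b : ℕ) : ℝ)) :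
    ∑ μ : Fin P.d, ((2 * t₂ z + 4 * t₁ z ^ 2) * |ψ z| + 2 * t₁ z * |ψ (torusT P 0 μ z) - ψ z| + 2 * t₁ z * |ψ ((torusT P 0 μ).symm z) - ψ z|)
      ≤ P.d * ((2 * (A₀ + A₂ * (9 * n + 2)) + 4 * (A₁ * (9 * n + 1)) ^ 2) * C + 8 * A₁ * C) := by
  have hr : ((Site.tdist z b : ℕ) : ℝ) ≤ 9 * n := by exact_mod_cast hz
  have hm0 : 0 < max 1 ((Site.tdist z b : ℕ) : ℝ) := lt_of_lt_of_le one_pos (le_max_left _ _)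
  have hT₁ : t₁ z ≤ A₁ * (9 * n + 1) := ht₁.2.trans (by nlinarith)
  have hT₂ : t₂ z ≤ A₀ + A₂ * (9 * n + 2) := ht₂.trans (by nlinarith)
  -- `2t₁·C/(1∨r) ≤ 4A₁C`
  have hstep : 2 * t₁ z * (C / max 1 ((Site.tdist z b : ℕ) : ℝ)) ≤ 4 * A₁ * C := by
    have h2 := add_one_le_two_mul_max (Site.tdist z b)
    have h3 : t₁ z * (C / max 1 ((Site.tdist z b : ℕ) : ℝ)) ≤ A₁ * ((Site.tdist z b : ℝ) + 1) * (C / max 1 ((Site.tdist z b : ℕ) : ℝ)) :=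
      mul_le_mul_of_nonneg_right ht₁.2 (by positivity)
    have h4 : A₁ * ((Site.tdist z b : ℝ) + 1) * (C / max 1 ((Site.tdist z b : ℕ) : ℝ)) ≤ A₁ * (2 * max 1 ((Site.tdist z b : ℕ) : ℝ)) * (C / max 1 ((Site.tdist z b : ℕ) : ℝ)) :=
      mul_le_mul_of_nonneg_right (mul_le_mul_of_nonneg_left h2 hA₁) (by positivity)
    have h5 : A₁ * (2 * max 1 ((Site.tdist z b : ℕ) : ℝ)) * (C / max 1 ((Site.tdist z b : ℕ) : ℝ)) = 2 * A₁ * C := by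
      field_simp
    nlinarith
  have hper : ∀ μ : Fin P.d, (2 * t₂ z + 4 * t₁ z ^ 2) * |ψ z| + 2 * t₁ z * |ψ (torusT P 0 μ z) - ψ z| + 2 * t₁ z * |ψ ((torusT P 0 μ).symm z) - ψ z|
      ≤ (2 * (A₀ + A₂ * (9 * n + 2)) + 4 * (A₁ * (9 * n + 1)) ^ 2) * C + 8 * A₁ * C := by
    intro μ
    have ha : 2 * t₁ z * |ψ (torusT P 0 μ z) - ψ z| ≤ 4 * A₁ * C :=
      (mul_le_mul_of_nonneg_left (hψ1 μ).1 (by nlinarith [ht₁.1])).trans hstep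
    have hb : 2 * t₁ z * |ψ ((torusT P 0 μ).symm z) - ψ z| ≤ 4 * A₁ * C :=
      (mul_le_mul_of_nonneg_left (hψ1 μ).2 (by nlinarith [ht₁.1])).trans hstep
    have hc0 : (2 * t₂ z + 4 * t₁ z ^ 2) * |ψ z| ≤ (2 * (A₀ + A₂ * (9 * n + 2)) + 4 * (A₁ * (9 * n + 1)) ^ 2) * C := by
      by_cases hs : 0 ≤ 2 * t₂ z + 4 * t₁ z ^ 2
      · have hsq : t₁ z ^ 2 ≤ (A₁ * (9 * n + 1)) ^ 2 := pow_le_pow_left₀ ht₁.1 hT₁ 2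
        calc (2 * t₂ z + 4 * t₁ z ^ 2) * |ψ z| ≤ (2 * t₂ z + 4 * t₁ z ^ 2) * C := mul_le_mul_of_nonneg_left hψ0 hs
          _ ≤ _ := by nlinarith
      · rw [not_le] at hs
        have hneg : (2 * t₂ z + 4 * t₁ z ^ 2) * |ψ z| ≤ 0 := mul_nonpos_of_nonpos_of_nonneg hs.le (abs_nonneg _)
        have hpos : 0 ≤ (2 * (A₀ + A₂ * (9 * n + 2)) + 4 * (A₁ * (9 * n + 1)) ^ 2) * C := by positivity
        linarith
    linarith
  calc _ ≤ ∑ _μ : Fin P.d, ((2 * (A₀ + A₂ * (9 * n + 2)) + 4 * (A₁ * (9 * n + 1)) ^ 2) * C + 8 * A₁ * C) := Finset.sum_le_sum fun μ _ => hper μ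
    _ = _ := by rw [Finset.sum_const, Finset.card_univ, Fintype.card_fin, nsmul_eq_mul]

/-- ★★ **THE gen-1 DENSITY TERM AT ONE SITE OF THE BALL** (the `g`-version): rows `|g| ≤ C∕(1∨r)²`, `|g(T_μ^{±}z) − g z| ≤ C∕(1∨r)³` give
`Σ_μ[(2t₂ z + 4(t₁ z)²)|g z| + 2t₁ z|g(T_μz) − g z| + 2t₁ z|g(T_μ⁻¹z) − g z|] ≤ d·((2(A₀ + A₂(9n+2)) + 4(A₁(9n+1))²)·C + 8A₁C)∕(1∨r)²`. [cite: Balaban1985BackgroundPropagators, (3.35) p.396] -/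
theorem density_term_le (b z : Site P 0) (n : ℕ) (hz : Site.tdist z b ≤ 9 * n) (g t₁ t₂ : Site P 0 → ℝ) {A₀ A₁ A₂ C : ℝ} (hA₀ : 0 ≤ A₀) (hA₁ : 0 ≤ A₁) (hA₂ : 0 ≤ A₂) (hC : 0 ≤ C)
    (ht₁ : 0 ≤ t₁ z ∧ t₁ z ≤ A₁ * ((Site.tdist z b : ℝ) + 1)) (ht₂ : t₂ z ≤ A₀ + A₂ * ((Site.tdist z b : ℝ) + 2))
    (hg0 : |g z| ≤ C / (max 1 ((Site.tdist z b : ℕ) : ℝ)) ^ 2)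
    (hg1 : ∀ μ, |g (torusT P 0 μ z) - g z| ≤ C / (max 1 ((Site.tdist z b : ℕ) : ℝ)) ^ 3 ∧ |g ((torusT P 0 μ).symm z) - g z| ≤ C / (max 1 ((Site.tdist z b : ℕ) : ℝ)) ^ 3) :
    ∑ μ : Fin P.d, ((2 * t₂ z + 4 * t₁ z ^ 2) * |g z| + 2 * t₁ z * |g (torusT P 0 μ z) - g z| + 2 * t₁ z * |g ((torusT P 0 μ).symm z) - g z|)
      ≤ P.d * (((2 * (A₀ + A₂ * (9 * n + 2)) + 4 * (A₁ * (9 * n + 1)) ^ 2) * C + 8 * A₁ * C) / (max 1 ((Site.tdist z b : ℕ) : ℝ)) ^ 2) := by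
  -- reduce to the previous lemma with `C ↦ C/(1∨r)²`
  set m : ℝ := max 1 ((Site.tdist z b : ℕ) : ℝ) with hm
  have hm0 : 0 < m := lt_of_lt_of_le one_pos (le_max_left _ _)
  have hC' : 0 ≤ C / m ^ 2 := by positivity
  have hg1' : ∀ μ, |g (torusT P 0 μ z) - g z| ≤ (C / m ^ 2) / max 1 ((Site.tdist z b : ℕ) : ℝ) ∧ |g ((torusT P 0 μ).symm z) - g z| ≤ (C / m ^ 2) / max 1 ((Site.tdist z b : ℕ) : ℝ) := by
    intro μ
    have e : (C / m ^ 2) / max 1 ((Site.tdist z b : ℕ) : ℝ) = C / m ^ 3 := by rw [← hm]; field_simp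
    rw [e]
    exact hg1 μ
  have h := junk_term_le b z n hz g t₁ t₂ hA₀ hA₁ hA₂ hC' ht₁ ht₂ hg0 hg1'
  refine h.trans (le_of_eq ?_)
  field_simp

/-! ## §3 ★★★ The gen-0 numbers -/

set_option maxHeartbeats 400000 in
/-- ★★★ **THE gen-0 NUMBERS** (see the module docstring).  Part (i): ✓p678469's scalars `ψ g c₁ c₂` at scale `n` with their support, identities and rows (re-exported for the downstream files); part (ii): for
every bi-contractive `U`, `Fr`, cone functions `t₁ t₂` with the displayed rows on `S`, every test matrix `Y` and weight `ω ≤ Ω` on `S`: (N2⁰) the `ℓ¹` number of `Δ_U(ψ•R(Fr)Y)`; (E₁) the pointwise size and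
the vanishing off `S` of `E₁ := Δ_U(ψ•RY) − (Δψ)•RY`; (H⁰) the weighted number of `E₁ + c₁•RY`; (S⁰) the weighted number of `c₂•RY`; (J) the pointwise density and vanishing of `E₂ := Δ_U(g•RY) − (Δg)•RY`.
[cite: Balaban1985BackgroundPropagators, (3.8) p.392, (3.35) p.396; Balaban1984PropagatorsII, (1.9) p.226; Balaban1985RegularSpaces, (1.36) p.82] -/
theorem exists_gen0_numbers : ∃ C : ℝ, 0 ≤ C ∧ ∀ (P : Params) (_ : P.d = 3) (k : ℕ) (_ : k ≤ P.m + P.K) (b : Site P 0) (μ₀ : Fin P.d) (n : ℕ) (_ : 2 ≤ n),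
    ∃ ψ g c₁ c₂ : Site P 0 → ℝ,
      -- (i) the flat scalars
      (∀ z, (9 * n : ℝ) ≤ (Site.tdist z b : ℝ) → ψ z = 0 ∧ g z = 0) ∧
      (∀ z, (9 * n : ℝ) + 1 ≤ (Site.tdist z b : ℝ) → c₁ z = 0 ∧ c₂ z = 0) ∧
      (∀ z, ∑ ν : Fin P.d, (2 * ψ z - ψ (torusT P 0 ν z) - ψ ((torusT P 0 ν).symm z)) = g z + c₁ z) ∧
      (∀ z, ∑ ν : Fin P.d, (2 * g z - g (torusT P 0 ν z) - g ((torusT P 0 ν).symm z))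
        = ((if z = b.shift μ₀ then (1 : ℝ) else 0) - (if z = b then (1 : ℝ) else 0)) + c₂ z) ∧
      (∀ z, |ψ z| ≤ C) ∧
      (∀ z ν, |ψ (torusT P 0 ν z) - ψ z| ≤ C / max 1 ((Site.tdist z b : ℕ) : ℝ) ∧ |ψ ((torusT P 0 ν).symm z) - ψ z| ≤ C / max 1 ((Site.tdist z b : ℕ) : ℝ)) ∧
      (∀ z, |c₁ z| ≤ C / (n : ℝ) ^ 2) ∧ (∀ z, |c₂ z| ≤ C / (n : ℝ) ^ 4) ∧
      -- (ii) the covariant numbers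
      ∀ {N : ℕ} (U : Fin P.d → Site P 0 → (Matrix (Fin N) (Fin N) ℂ)ˣ) (Fr : Site P 0 → (Matrix (Fin N) (Fin N) ℂ)ˣ)
        (_ : ∀ (κ : Fin P.d) (y : Site P 0), ‖(U κ y : Matrix (Fin N) (Fin N) ℂ)‖ ≤ 1 ∧ ‖(((U κ y)⁻¹ : (Matrix (Fin N) (Fin N) ℂ)ˣ) : Matrix (Fin N) (Fin N) ℂ)‖ ≤ 1)
        (_ : ∀ z : Site P 0, ‖(Fr z : Matrix (Fin N) (Fin N) ℂ)‖ ≤ 1 ∧ ‖(((Fr z)⁻¹ : (Matrix (Fin N) (Fin N) ℂ)ˣ) : Matrix (Fin N) (Fin N) ℂ)‖ ≤ 1)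
        (t₁ t₂ : Site P 0 → ℝ) (A₀ A₁ A₂ : ℝ) (_ : 0 ≤ A₀) (_ : 0 ≤ A₁) (_ : 0 ≤ A₂)
        (_ : ∀ z ∈ (univ.filter fun z : Site P 0 => Site.tdist z b ≤ 9 * n), 0 ≤ t₁ z ∧ t₁ z ≤ A₁ * ((Site.tdist z b : ℝ) + 1))
        (_ : ∀ z ∈ (univ.filter fun z : Site P 0 => Site.tdist z b ≤ 9 * n), t₂ z ≤ A₀ + A₂ * ((Site.tdist z b : ℝ) + 2))
        (_ : ∀ z ∈ (univ.filter fun z : Site P 0 => Site.tdist z b ≤ 9 * n), ∀ μ,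
          ‖(((Fr z)⁻¹ * U μ z * Fr (torusT P 0 μ z) : (Matrix (Fin N) (Fin N) ℂ)ˣ) : Matrix (Fin N) (Fin N) ℂ) - 1‖ ≤ t₁ z)
        (_ : ∀ z ∈ (univ.filter fun z : Site P 0 => Site.tdist z b ≤ 9 * n), ∀ μ,
          ‖(((Fr ((torusT P 0 μ).symm z))⁻¹ * U μ ((torusT P 0 μ).symm z) * Fr (torusT P 0 μ ((torusT P 0 μ).symm z)) : (Matrix (Fin N) (Fin N) ℂ)ˣ) :
            Matrix (Fin N) (Fin N) ℂ) - 1‖ ≤ t₁ z)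
        (_ : ∀ z ∈ (univ.filter fun z : Site P 0 => Site.tdist z b ≤ 9 * n), ∀ μ,
          ‖(((Fr z)⁻¹ * U μ z * Fr (torusT P 0 μ z) : (Matrix (Fin N) (Fin N) ℂ)ˣ) : Matrix (Fin N) (Fin N) ℂ)
            - (((Fr ((torusT P 0 μ).symm z))⁻¹ * U μ ((torusT P 0 μ).symm z) * Fr (torusT P 0 μ ((torusT P 0 μ).symm z)) : (Matrix (Fin N) (Fin N) ℂ)ˣ) :
              Matrix (Fin N) (Fin N) ℂ)‖ ≤ t₂ z)
        (Y : Matrix (Fin N) (Fin N) ℂ) (ω : Site P 0 → ℝ) (Ω : ℝ) (_ : ∀ z ∈ (univ.filter fun z : Site P 0 => Site.tdist z b ≤ 9 * n), 0 ≤ ω z ∧ ω z ≤ Ω),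
        -- (N2⁰)
        (∑ z, Real.sqrt (∑ j : Fin N, ∑ k' : Fin N, ‖(divB (torusT P 0) U (fun μ => covD (torusT P 0) U μ (fun y => ψ y • R (Fr y) Y)) z) j k'‖ ^ 2)
          ≤ Real.sqrt (∑ j : Fin N, ∑ k' : Fin N, ‖Y j k'‖ ^ 2) * (C * (9 + 192 * (9 * n)) + (2 * ((9 * n : ℝ) + 1)) ^ P.d * (C / (n : ℝ) ^ 2))
            + Real.sqrt N * (‖Y‖ * ((2 * ((9 * n : ℝ) + 1)) ^ P.d * (P.d * ((2 * (A₀ + A₂ * (9 * n + 2)) + 4 * (A₁ * (9 * n + 1)) ^ 2) * C + 8 * A₁ * C))))) ∧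
        -- (E₁) pointwise on `S`, zero off `S`
        (∀ E₁ : Site P 0 → Matrix (Fin N) (Fin N) ℂ,
          (∀ z, E₁ z = divB (torusT P 0) U (fun μ => covD (torusT P 0) U μ (fun y => ψ y • R (Fr y) Y)) z
            - (∑ ν : Fin P.d, (2 * ψ z - ψ (torusT P 0 ν z) - ψ ((torusT P 0 ν).symm z))) • R (Fr z) Y) →
          (∀ z ∈ (univ.filter fun z : Site P 0 => Site.tdist z b ≤ 9 * n),
              ‖E₁ z‖ ≤ P.d * ((2 * (A₀ + A₂ * (9 * n + 2)) + 4 * (A₁ * (9 * n + 1)) ^ 2) * C + 8 * A₁ * C) * ‖Y‖) ∧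
          (∀ z ∉ (univ.filter fun z : Site P 0 => Site.tdist z b ≤ 9 * n), E₁ z = 0) ∧
          -- (H⁰)
          Real.sqrt (∑ z, ω z ^ 2 * ∑ j : Fin N, ∑ k' : Fin N, ‖(E₁ z + c₁ z • R (Fr z) Y) j k'‖ ^ 2)
            ≤ Ω * Real.sqrt (((univ.filter fun z : Site P 0 => Site.tdist z b ≤ 9 * n)).card : ℝ)
              * (Real.sqrt N * (P.d * ((2 * (A₀ + A₂ * (9 * n + 2)) + 4 * (A₁ * (9 * n + 1)) ^ 2) * C + 8 * A₁ * C) * ‖Y‖)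
                + C / (n : ℝ) ^ 2 * Real.sqrt (∑ j : Fin N, ∑ k' : Fin N, ‖Y j k'‖ ^ 2))) ∧
        -- (S⁰)
        Real.sqrt (∑ z, ω z ^ 2 * ∑ j : Fin N, ∑ k' : Fin N, ‖(c₂ z • R (Fr z) Y) j k'‖ ^ 2)
          ≤ Ω * Real.sqrt (((univ.filter fun z : Site P 0 => Site.tdist z b ≤ 9 * n)).card : ℝ) * (C / (n : ℝ) ^ 4 * Real.sqrt (∑ j : Fin N, ∑ k' : Fin N, ‖Y j k'‖ ^ 2)) ∧
        -- (J) the gen-1 density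
        (∀ E₂ : Site P 0 → Matrix (Fin N) (Fin N) ℂ,
          (∀ z, E₂ z = divB (torusT P 0) U (fun μ => covD (torusT P 0) U μ (fun y => g y • R (Fr y) Y)) z
            - (∑ ν : Fin P.d, (2 * g z - g (torusT P 0 ν z) - g ((torusT P 0 ν).symm z))) • R (Fr z) Y) →
          (∀ z ∈ (univ.filter fun z : Site P 0 => Site.tdist z b ≤ 9 * n),
              ‖E₂ z‖ ≤ P.d * (((2 * (A₀ + A₂ * (9 * n + 2)) + 4 * (A₁ * (9 * n + 1)) ^ 2) * C + 8 * A₁ * C) / (max 1 ((Site.tdist z b : ℕ) : ℝ)) ^ 2) * ‖Y‖) ∧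
          (∀ z ∉ (univ.filter fun z : Site P 0 => Site.tdist z b ≤ 9 * n), E₂ z = 0)) := by
  obtain ⟨C, hC, H⟩ := exists_cutoffPotential
  refine ⟨C, hC, ?_⟩
  intro P hd k hk b μ₀ n hn
  classical
  have hn2 : (2 : ℝ) ≤ n := by exact_mod_cast hn
  have hn0 : (0 : ℝ) < n := by linarith
  obtain ⟨ψ, g, c₁, c₂, hsupp, hsuppc, hid1, hid2, hψ0, hψ1, hg0, hg1, hc₁, hc₂⟩ := H P hd k hk b μ₀ (n : ℝ) hn2
  refine ⟨ψ, g, c₁, c₂, hsupp, hsuppc, hid1, hid2, hψ0, hψ1, hc₁, hc₂, ?_⟩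
  intro N U Fr hU hFr t₁ t₂ A₀ A₁ A₂ hA₀ hA₁ hA₂ ht₁ ht₂ h1 h1' h2 Y ω Ω hω
  set S : Finset (Site P 0) := univ.filter fun z : Site P 0 => Site.tdist z b ≤ 9 * n with hSdef
  set B : ℝ := (2 * (A₀ + A₂ * (9 * n + 2)) + 4 * (A₁ * (9 * n + 1)) ^ 2) * C + 8 * A₁ * C with hBdef
  have hB0 : 0 ≤ B := by rw [hBdef]; positivity
  have hY0 : 0 ≤ Real.sqrt (∑ j : Fin N, ∑ k' : Fin N, ‖Y j k'‖ ^ 2) := Real.sqrt_nonneg _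
  -- support facts on `S`
  have hψS : ∀ z ∉ S, ψ z = 0 ∧ (∀ μ, ψ (torusT P 0 μ z) = 0) ∧ ∀ μ, ψ ((torusT P 0 μ).symm z) = 0 := by
    intro z hz
    obtain ⟨h0, hs, hu⟩ := not_mem_ball b z n hz
    exact ⟨(hsupp z (by linarith)).1, fun μ => (hsupp _ (hs μ)).1, fun μ => (hsupp _ (hu μ)).1⟩
  have hgS : ∀ z ∉ S, g z = 0 ∧ (∀ μ, g (torusT P 0 μ z) = 0) ∧ ∀ μ, g ((torusT P 0 μ).symm z) = 0 := by
    intro z hz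
    obtain ⟨h0, hs, hu⟩ := not_mem_ball b z n hz
    exact ⟨(hsupp z (by linarith)).2, fun μ => (hsupp _ (hs μ)).2, fun μ => (hsupp _ (hu μ)).2⟩
  have hcS : ∀ z ∉ S, c₁ z = 0 ∧ c₂ z = 0 := fun z hz => hsuppc z (not_mem_ball b z n hz).1
  have hmemS : ∀ z ∈ S, Site.tdist z b ≤ 9 * n := fun z hz => (mem_ball_iff b z (9 * n)).1 hz
  have hcard : (S.card : ℝ) ≤ (2 * ((9 * n : ℝ) + 1)) ^ P.d := card_ball_le b n
  -- the flat Laplacians vanish off `S`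
  have hΔψ0 : ∀ z ∉ S, ∑ ν : Fin P.d, (2 * ψ z - ψ (torusT P 0 ν z) - ψ ((torusT P 0 ν).symm z)) = 0 := by
    intro z hz
    obtain ⟨h0, hs, hu⟩ := hψS z hz
    simp only [h0, hs, hu, mul_zero, sub_zero, Finset.sum_const_zero]
  have hΔg0 : ∀ z ∉ S, ∑ ν : Fin P.d, (2 * g z - g (torusT P 0 ν z) - g ((torusT P 0 ν).symm z)) = 0 := by
    intro z hz
    obtain ⟨h0, hs, hu⟩ := hgS z hz
    simp only [h0, hs, hu, mul_zero, sub_zero, Finset.sum_const_zero]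
  -- the junk∕density terms on `S`
  have hjunk : ∀ z ∈ S, ∑ μ : Fin P.d, ((2 * t₂ z + 4 * t₁ z ^ 2) * |ψ z| + 2 * t₁ z * |ψ (torusT P 0 μ z) - ψ z| + 2 * t₁ z * |ψ ((torusT P 0 μ).symm z) - ψ z|)
      ≤ P.d * B := fun z hz => junk_term_le b z n (hmemS z hz) ψ t₁ t₂ hA₀ hA₁ hA₂ hC (ht₁ z hz) (ht₂ z hz) (hψ0 z) (hψ1 z)
  have hdens : ∀ z ∈ S, ∑ μ : Fin P.d, ((2 * t₂ z + 4 * t₁ z ^ 2) * |g z| + 2 * t₁ z * |g (torusT P 0 μ z) - g z| + 2 * t₁ z * |g ((torusT P 0 μ).symm z) - g z|)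
      ≤ P.d * (B / (max 1 ((Site.tdist z b : ℕ) : ℝ)) ^ 2) := fun z hz =>
    density_term_le b z n (hmemS z hz) g t₁ t₂ hA₀ hA₁ hA₂ hC (ht₁ z hz) (ht₂ z hz) (hg0 z) (hg1 z)
  refine ⟨?_, ?_, ?_, ?_⟩
  · -- (N2⁰)
    have h := sum_sqrt_hs_covLaplace_framedConst_le U Fr hU hFr ψ Y S hψS t₁ t₂ h1 h1' h2
    refine h.trans ?_
    -- main term: `Σ_S |Δψ| ≤ Σ_S (|g| + |c₁|)`
    have hmain : ∑ z ∈ S, |∑ ν : Fin P.d, (2 * ψ z - ψ (torusT P 0 ν z) - ψ ((torusT P 0 ν).symm z))| ≤ C * (9 + 192 * (9 * n)) + (2 * ((9 * n : ℝ) + 1)) ^ P.d * (C / (n : ℝ) ^ 2) := by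
      calc _ ≤ ∑ z ∈ S, (C * ((max 1 ((Site.tdist z b : ℕ) : ℝ)) ^ 2)⁻¹ + C / (n : ℝ) ^ 2) := by
            refine Finset.sum_le_sum fun z _ => ?_
            rw [hid1 z]
            refine (abs_add_le _ _).trans ?_
            have := hg0 z
            have e : C / (max 1 ((Site.tdist z b : ℕ) : ℝ)) ^ 2 = C * ((max 1 ((Site.tdist z b : ℕ) : ℝ)) ^ 2)⁻¹ := by rw [div_eq_mul_inv]
            linarith [hc₁ z]
        _ = C * ∑ z ∈ S, ((max 1 ((Site.tdist z b : ℕ) : ℝ)) ^ 2)⁻¹ + S.card * (C / (n : ℝ) ^ 2) := by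
            rw [Finset.sum_add_distrib, Finset.mul_sum, Finset.sum_const, nsmul_eq_mul]
        _ ≤ C * (8 + 192 * ((9 * n : ℕ) : ℝ)) + (2 * ((9 * n : ℝ) + 1)) ^ P.d * (C / (n : ℝ) ^ 2) := by
            have hs := sum_inv_max_sq_le hd S b (9 * n) hmemS
            have h2 : S.card * (C / (n : ℝ) ^ 2) ≤ (2 * ((9 * n : ℝ) + 1)) ^ P.d * (C / (n : ℝ) ^ 2) := mul_le_mul_of_nonneg_right hcard (by positivity)
            nlinarith [mul_le_mul_of_nonneg_left hs hC]
        _ ≤ _ := by push_cast; nlinarith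
    have hj : ∑ z ∈ S, ∑ μ : Fin P.d, ((2 * t₂ z + 4 * t₁ z ^ 2) * |ψ z| + 2 * t₁ z * |ψ (torusT P 0 μ z) - ψ z| + 2 * t₁ z * |ψ ((torusT P 0 μ).symm z) - ψ z|)
        ≤ (2 * ((9 * n : ℝ) + 1)) ^ P.d * (P.d * B) := by
      calc _ ≤ ∑ _z ∈ S, (P.d : ℝ) * B := Finset.sum_le_sum hjunk
        _ = S.card * (P.d * B) := by rw [Finset.sum_const, nsmul_eq_mul]
        _ ≤ _ := mul_le_mul_of_nonneg_right hcard (by positivity)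
    have hN0 : 0 ≤ Real.sqrt (N : ℝ) * ‖Y‖ := mul_nonneg (Real.sqrt_nonneg _) (norm_nonneg _)
    calc _ ≤ Real.sqrt (∑ j : Fin N, ∑ k' : Fin N, ‖Y j k'‖ ^ 2) * (C * (9 + 192 * (9 * n)) + (2 * ((9 * n : ℝ) + 1)) ^ P.d * (C / (n : ℝ) ^ 2))
          + Real.sqrt N * (‖Y‖ * ((2 * ((9 * n : ℝ) + 1)) ^ P.d * (P.d * B))) := by
          have a1 := mul_le_mul_of_nonneg_left hmain hY0
          have a2 := mul_le_mul_of_nonneg_left hj hN0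
          nlinarith
      _ = _ := by rw [hBdef]
  · -- (E₁) and (H⁰)
    intro E₁ hE₁
    have hE₁S : ∀ z ∈ S, ‖E₁ z‖ ≤ P.d * B * ‖Y‖ := by
      intro z hz
      rw [hE₁ z]
      have h := norm_covLaplace_framedConst_sub_le (torusT P 0) U Fr hU hFr ψ Y z (h1 z hz) (h1' z hz) (h2 z hz)
      refine h.trans ?_
      rw [← Finset.sum_mul]
      exact mul_le_mul_of_nonneg_right (hjunk z hz) (norm_nonneg _)
    have hE₁0 : ∀ z ∉ S, E₁ z = 0 := by
      intro z hz
      rw [hE₁ z, hΔψ0 z hz, zero_smul, sub_zero]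
      obtain ⟨h0, hs, hu⟩ := hψS z hz
      exact covLaplace_eq_zero_of_vanish U _ z (by simp only [h0, zero_smul]) (fun μ => by simp only [hs μ, zero_smul]) (fun μ => by simp only [hu μ, zero_smul])
    refine ⟨hE₁S, hE₁0, ?_⟩
    -- pointwise `√hs(E₁ + c₁•RY) ≤ √N·d·B·‖Y‖ + (C/n²)√hs Y`
    have hpt : ∀ z ∈ S, Real.sqrt (∑ j : Fin N, ∑ k' : Fin N, ‖(E₁ z + c₁ z • R (Fr z) Y) j k'‖ ^ 2)
        ≤ Real.sqrt N * (P.d * B * ‖Y‖) + C / (n : ℝ) ^ 2 * Real.sqrt (∑ j : Fin N, ∑ k' : Fin N, ‖Y j k'‖ ^ 2) := by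
      intro z hz
      refine (sqrt_hs_add_le _ _).trans (add_le_add ?_ ?_)
      · exact (sqrt_hs_le_sqrt_card_mul_norm (E₁ z)).trans (mul_le_mul_of_nonneg_left (hE₁S z hz) (Real.sqrt_nonneg _))
      · rw [sqrt_hs_smul]
        exact mul_le_mul (hc₁ z) (Real.sqrt_le_sqrt (hs_R_le (hFr z) Y)) (Real.sqrt_nonneg _) (by positivity)
    have hvan : ∀ z ∉ S, (fun z => E₁ z + c₁ z • R (Fr z) Y) z = 0 := by
      intro z hz
      show E₁ z + c₁ z • R (Fr z) Y = 0
      rw [hE₁0 z hz, (hcS z hz).1, zero_smul, add_zero]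
    have hB1 : 0 ≤ Real.sqrt N * (P.d * B * ‖Y‖) + C / (n : ℝ) ^ 2 * Real.sqrt (∑ j : Fin N, ∑ k' : Fin N, ‖Y j k'‖ ^ 2) := by positivity
    exact sqrt_weighted_hs_le_of_pointwise S (fun z => E₁ z + c₁ z • R (Fr z) Y) hvan ω hω hB1 hpt
  · -- (S⁰)
    have hpt : ∀ z ∈ S, Real.sqrt (∑ j : Fin N, ∑ k' : Fin N, ‖(c₂ z • R (Fr z) Y) j k'‖ ^ 2) ≤ C / (n : ℝ) ^ 4 * Real.sqrt (∑ j : Fin N, ∑ k' : Fin N, ‖Y j k'‖ ^ 2) := by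
      intro z _
      rw [sqrt_hs_smul]
      exact mul_le_mul (hc₂ z) (Real.sqrt_le_sqrt (hs_R_le (hFr z) Y)) (Real.sqrt_nonneg _) (by positivity)
    have hvan : ∀ z ∉ S, (fun z => c₂ z • R (Fr z) Y) z = 0 := fun z hz => by
      show c₂ z • R (Fr z) Y = 0
      rw [(hcS z hz).2, zero_smul]
    have hB2 : 0 ≤ C / (n : ℝ) ^ 4 * Real.sqrt (∑ j : Fin N, ∑ k' : Fin N, ‖Y j k'‖ ^ 2) := by positivity
    exact sqrt_weighted_hs_le_of_pointwise S (fun z => c₂ z • R (Fr z) Y) hvan ω hω hB2 hpt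
  · -- (J)
    intro E₂ hE₂
    refine ⟨fun z hz => ?_, fun z hz => ?_⟩
    · rw [hE₂ z]
      have h := norm_covLaplace_framedConst_sub_le (torusT P 0) U Fr hU hFr g Y z (h1 z hz) (h1' z hz) (h2 z hz)
      refine h.trans ?_
      rw [← Finset.sum_mul]
      exact mul_le_mul_of_nonneg_right (hdens z hz) (norm_nonneg _)
    · rw [hE₂ z, hΔg0 z hz, zero_smul, sub_zero]
      obtain ⟨h0, hs, hu⟩ := hgS z hz
      exact covLaplace_eq_zero_of_vanish U _ z (by simp only [h0, zero_smul]) (fun μ => by simp only [hs μ, zero_smul]) (fun μ => by simp only [hu μ, zero_smul])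

end Summit.QuantumFields.YangMills.Theorems.Prop7TransplantGen0Numbers

end
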